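import Literature.MathematicalPhysics.QuantumFieldTheory.Balaban1983to89.B8Ineq132Rec
import Literature.MathematicalPhysics.QuantumFieldTheory.Balaban1983to89.B8Eq131Cubes

/-!
# `Balaban1983to89.B8Eq131CubesRec` — [Balaban1985RegularSpaces] p. 98 and (1.131) p. 99: the family of cubes `□ ⊂ □_k ⊂ … ⊂ □₀ ⊂ □̃`, the sets `Λ′_j`, `ℭ_k`,
# and (1.132)∕(1.133) for THIS family — ON THE RECORD's CENTRED TOWER ([Balaban1987RG1] (0.3)–(0.4)); the record twin of `B8Eq131Cubes` (LEAD PEN dag-n05-e; cell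
# member dag-n05-d)

statement-level skeleton of published theorems with citation tags; proofs where landed; nothing here is a claim about the Yang–Mills mass gap

CITATION HEADER.  [6] = [Balaban1985RegularSpaces], p. 98: *«Let us take a sequence of cubes □₀, □₁, …, □_{k−1}, □_k, □, such that □_j ⊃ □_{j+1} and a distance between
boundaries of these cubes is equal to R₁M₁Lʲη. … We cover □₀ by a smallest family of cubes of the size R₁M₁. A sum of these cubes is a cube which we denote by □̃. A distance of
its boundary to □ is equal to 2R₁M₁. … thus we have □̃ ⊂ Ω_{k−1}. … for every j the cube □_j is a sum of the big blocks of the lattice T_{L^{−j}} … where y is a center of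
□̃^{(k)}.»*; p. 99 (1.131) *«Λ′_j = □_j^{(j)} ∖ □_{j+1}^{(j)}, j = 1, …, k − 1, Λ′_k = □_k^{(k)}, Λ′₀ = T ∖ □₁, ℭ_k = ⋃_{j=0}^{k} Λ′_j»*, (1.132)–(1.133); (1.3)–(1.4) p. 77;
[I] = [Balaban1987RG1] (0.3) p. 252 (CENTRED blocks `Bᵏ(y) = {x : |x_μ − Lᵏy_μ| ≤ (Lᵏ−1)∕2}`), (0.4) p. 253.  Cell `pub-ymgap`, seat dag-n05-d g23, «N05-REC» road item R4
(TOKEN RULE (T1) `avgIter ↦ avgIterZ`, (T2) centred tower `B8Ineq130Rec.tlo ∕ thi` — so every blown-up box is the engine's box SHIFTED BY `−ctrShift L n·𝟙` at depth `n`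
(`B8Ineq130Rec.tlo_eq_engine_sub`), `Under ↦ B8Eq119TwistedAxialRec.UnderZ`, `InAxOne ↦ InAxOneZ`, `cutFixed ↦ B8Ineq133Rec.cutFixedZ`; (T5) engine names, definition
twins `+Z`: `bLoZ bHiZ sqLoZ sqHiZ inLoZ inHiZ boxZ cubeZ tcubeZ LamPZ`; `flmZ` is `B8Eq119TwistedAxialRec`'s).  REUSED verbatim (class 0 — depth-0 objects and pure arithmetic): `B8Eq131Cubes.gs ∕ gs_succ ∕
margin_succ ∕ margin_top ∕ margin_anti ∕ margin_collar ∕ margin_own ∕ tLo ∕ tHi ∕ ctr ∕ crad ∕ ctr_mem ∕ two_crad_le ∕ tLo_le_tHi ∕ l1dist`, `B8Ineq132.geom_margin`.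
`--kind definition --supports stmt-QuantumFields-20541` (K0⁷; count-neutral).

WHAT IS DEFINED ∕ PROVED (sorry-free).  §0 the centred margin boxes `bLoZ ∕ bHiZ`
(`= □^{(depth n)}` blown up with CENTRED blocks, widened by `m`), `tlo_bLo ∕ thi_bHi` (the centred tower multiplies margins by `Lᵖ`), monotonicity.  §1 the printed objects
`sqLoZ ∕ sqHiZ` (`□_j^{(j)}`), `inLoZ ∕ inHiZ` (`□_{j+1}^{(j)}`), `boxZ` (`□`), `cubeZ j` (`□_j = Bʲ(□_j^{(j)})`, centred), `tcubeZ` (`□̃`), ★`LamPZ j` (`Λ′_j` exactly as (1.131)).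
§2 fine-lattice descriptions `cube_eq ∕ tcube_eq ∕ tlo_tLo ∕ thi_tHi`.  §3 the inclusions `cube_succ_subset` (`□_{j+1} ⊂ □_j`), `box_subset_cube_top`, `cube_anti`, `box_subset_cube`,
`cube_subset_tcube` (`□_j ⊂ □̃`), ★`collar_cube`, `sq_le_tilde`, ★`lamP_subset` (`Λ′_j ⊂ □̃^{(j)}`), `box_subset_lamP_top`, `inner_eq_blowup` (`□_{j+1}^{(j)} = B(□_{j+1}^{(j+1)})`,
centred), `inner_top`.  §4 ★block compatibility `mem_cube_iff` («□_j is a sum of the big blocks», centred, via `B8Eq119TwistedAxialRec.flmZ ∕ underZ_flmZ`).  §5 ★`tcube_subset_of_sep` («thus □̃ ⊂ Ω_{k−1}»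
PROVED from `□ ⊂ Ω_k`, (1.4) at level `k − 1`, `2dR₁M₁L < RM₁`), `cube_subset_Omega`.  §6 ★★★ `ineq132_cubes` — (1.132) `U₀″ ∈ 𝔄_k({□_j}, L³α₀) ∩ Ax_k(ℭ_k, 1)` and (1.133)
on the bonds of `□_j^{(j)}`, `j = 0, …, k`, for `U₀″ = cutFixedZ` over `□̃^{(k)} = [a − 2ρ, a + M − 1 + 2ρ]ᵈ` with centre `ctr` (every orbit, every `AvgClosedZ` gauge group, odd
`L ≥ 3`), all geometric hypotheses of `B8Ineq132Rec.ineq132` DISCHARGED; `ineq132_cubes_of_sep` (with print's derivation of `□̃ ⊂ Ω_{k−1}`).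
HONEST SCOPE.  As the engine module (its DICTIONARY ∕ HONEST SCOPE apply verbatim: `T_η ↦ ℤᵈ`; `□̃ := □` widened by `2R₁M₁`; (1.4)'s dist read in `ℓ¹`; `{□_j}` satisfying
(1.4) itself NOT asserted); odd `L ≥ 3`; `HThm4Rec` UNDISCHARGED; N05 ∕ N07 NOT discharged; counts unmoved; one finite 𝕋⁴ programme at fixed ε — nothing continuum ∕ ℝ⁴ ∕ OS ∕
mass gap ∕ Clay.  No `instance`, no `notation`, no `sorry`.
-/

noncomputable section

open scoped BigOperators
open Finset

namespace Literature.MathematicalPhysics.QuantumFieldTheory.Balaban1983to89.B8Eq131CubesRec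

open B7Prop1Explicit B7Prop1Local B7AvgGaugeCovariance BlockAveragingZd B8Lemma1NonAbelianRecLoops B8Ineq130Rec B8Eq115GaugeFixingRec B8Ineq128Rec
  B8Ineq133Rec B8Ineq132Rec
open B7Prop2Explicit (pdev c2' C0)
open B7Prop2Rec (AvgClosedZ C0Z)
open B8Ineq130 (inBox_of_le)
open B8Ineq132 (InAk Collar geom_margin)
open B8Eq119TwistedAxialRec (UnderZ InAxOneZ underZ_tower ctrShift_add flmZ underZ_flmZ)
open B8Eq131Cubes (gs gs_zero gs_succ one_le_gs margin_succ margin_top margin_anti margin_zero margin_collar margin_own tLo tHi ctr crad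
  ctr_mem two_crad_le tLo_le_tHi l1dist)

export B7Prop1Explicit (Site)

variable {d : ℕ}

section Geometry

/-! ## §0. The centred shift along the tower; boxes with a margin, centred blow-up -/

/-- (RECORD TWIN of `B8Eq131Cubes.bLo`.) The box of the depth-`n` lattice obtained from `□^{(depth n)}` — the CENTRED blow-up `[Lⁿa − cₙ, Lⁿ(a + M) − 1 − cₙ]ᵈ`,
`cₙ = ctrShift L n`, of `[a, a + M − 1]ᵈ` — by adding a margin `m` on every side: lower corner. [cite: Balaban1985RegularSpaces, p.98; Balaban1987RG1, (0.3) p.252] -/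
def bLoZ (L : ℕ) (a : Site d) (n m : ℕ) : Site d := fun i => (L : ℤ) ^ n * a i - ctrShift L n - m

/-- (RECORD TWIN of `B8Eq131Cubes.bHi`.) Upper corner of the same box. [cite: Balaban1985RegularSpaces, p.98; Balaban1987RG1, (0.3) p.252] -/
def bHiZ (L : ℕ) (a : Site d) (M n m : ℕ) : Site d := fun i => (L : ℤ) ^ n * (a i + M) - 1 - ctrShift L n + m

/-- Blowing a margin box up by `Lᵖ` along the CENTRED tower (`B8Ineq130Rec.tlo`) multiplies the margin by `Lᵖ` (odd `L`). [cite: Balaban1985RegularSpaces, p.98; Balaban1987RG1, (0.3) p.252] -/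
theorem tlo_bLo {L : ℕ} (hL : Odd L) (a : Site d) (n m p : ℕ) : tlo L (bLoZ L a n m) p = bLoZ L a (n + p) (L ^ p * m) := by
  funext i
  rw [tlo_apply hL]
  simp only [bLoZ]
  rw [ctrShift_add hL n p]
  push_cast
  ring

/-- Same for the upper corner (`thi`). [cite: Balaban1985RegularSpaces, p.98; Balaban1987RG1, (0.3) p.252] -/
theorem thi_bHi {L : ℕ} (hL : Odd L) (a : Site d) (M n m p : ℕ) :
    thi L (bHiZ L a M n m) p = bHiZ L a M (n + p) (L ^ p * m) := by
  funext i
  rw [thi_apply hL]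
  simp only [bHiZ]
  have hcp : 2 * (ctrShift L p : ℤ) + 1 = (L : ℤ) ^ p := by exact_mod_cast two_mul_ctrShift_add_one hL p
  rw [ctrShift_add hL n p]
  push_cast
  linear_combination hcp

/-- A box with a smaller margin lies in the box with a larger margin. [cite: Balaban1985RegularSpaces, p.98 (bookkeeping)] -/
theorem inBox_margin_mono {L : ℕ} {a : Site d} {M n m m' : ℕ} (h : m ≤ m') {x : Site d}
    (hx : InBox (bLoZ L a n m) (bHiZ L a M n m) x) : InBox (bLoZ L a n m') (bHiZ L a M n m') x := by
  intro i
  obtain ⟨h1, h2⟩ := hx i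
  simp only [bLoZ, bHiZ] at h1 h2 ⊢
  have hm : (m : ℤ) ≤ m' := by exact_mod_cast h
  constructor <;> linarith

/-- Componentwise form of the same monotonicity. [cite: Balaban1985RegularSpaces, p.98 (bookkeeping)] -/
theorem le_of_margin_mono {L : ℕ} {a : Site d} {M n m m' : ℕ} (h : m ≤ m') :
    bLoZ L a n m' ≤ bLoZ L a n m ∧ bHiZ L a M n m ≤ bHiZ L a M n m' := by
  have hm : (m : ℤ) ≤ m' := by exact_mod_cast h
  constructor <;> intro i <;> simp only [bLoZ, bHiZ] <;> linarith

/-! ## §1. The printed objects of p. 98 and (1.131): `□`, `□_j`, `□̃`, `Λ′_j`, centred tower -/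

/-- `tLo` (engine, depth `0`) is the margin-`2ρ` centred box at depth `0`. [cite: Balaban1985RegularSpaces, p.98 ("A distance of its boundary to □ is equal to 2R₁M₁")] -/
theorem tLo_eq (L : ℕ) (a : Site d) (ρ : ℕ) : tLo a ρ = bLoZ L a 0 (2 * ρ) := by
  funext i; simp [tLo, bLoZ]

/-- `tHi` (engine, depth `0`) is the margin-`2ρ` centred box at depth `0`. [cite: Balaban1985RegularSpaces, p.98 ("A distance of its boundary to □ is equal to 2R₁M₁")] -/
theorem tHi_eq (L : ℕ) (a : Site d) (M ρ : ℕ) : tHi a M ρ = bHiZ L a M 0 (2 * ρ) := by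
  funext i; simp [tHi, bHiZ]

/-- (RECORD TWIN of `sqLo`.) Lower corner of `□_j^{(j)}` (depth `k − j`, centred blow-up): margin `ρ·gs L (k − j)` around `□^{(j)}`. [cite: Balaban1985RegularSpaces, p.98 ("a distance between boundaries of these cubes is equal to R₁M₁Lʲη")] -/
def sqLoZ (L : ℕ) (a : Site d) (ρ k j : ℕ) : Site d := bLoZ L a (k - j) (ρ * gs L (k - j))

/-- (RECORD TWIN of `sqHi`.) Upper corner of `□_j^{(j)}`. [cite: Balaban1985RegularSpaces, p.98 ("a distance between boundaries of these cubes is equal to R₁M₁Lʲη")] -/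
def sqHiZ (L : ℕ) (a : Site d) (M ρ k j : ℕ) : Site d := bHiZ L a M (k - j) (ρ * gs L (k - j))

/-- (RECORD TWIN of `inLo`.) Lower corner of `□_{j+1}^{(j)}`: margin `ρ·(gs L (k − j) − 1)`. [cite: Balaban1985RegularSpaces, (1.131) p.99] -/
def inLoZ (L : ℕ) (a : Site d) (ρ k j : ℕ) : Site d := bLoZ L a (k - j) (ρ * (gs L (k - j) - 1))

/-- (RECORD TWIN of `inHi`.) Upper corner of `□_{j+1}^{(j)}`. [cite: Balaban1985RegularSpaces, (1.131) p.99] -/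
def inHiZ (L : ℕ) (a : Site d) (M ρ k j : ℕ) : Site d := bHiZ L a M (k - j) (ρ * (gs L (k - j) - 1))

/-- (RECORD TWIN of `box`.) `□` as a set of sites of `T_η` (depth `k`), centred blow-up of `[a, a + M − 1]ᵈ`. [cite: Balaban1985RegularSpaces, p.98 ("we take a size of □ equal to MLʲη"); Balaban1987RG1, (0.3) p.252] -/
def boxZ (L : ℕ) (a : Site d) (M k : ℕ) : Set (Site d) := {x | InBox (bLoZ L a k 0) (bHiZ L a M k 0) x}

/-- (RECORD TWIN of `cube`.) `□_j` as a set of sites of `T_η`, `j ≤ k`: the CENTRED `Lʲ`-blow-up of `□_j^{(j)}` («for every j the cube □_j is a sum of the big blocks of the lattice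
T_{L^{−j}}»). [cite: Balaban1985RegularSpaces, p.98; Balaban1987RG1, (0.3) p.252] -/
def cubeZ (L : ℕ) (a : Site d) (M ρ k j : ℕ) : Set (Site d) :=
  {x | InBox (tlo L (sqLoZ L a ρ k j) j) (thi L (sqHiZ L a M ρ k j) j) x}

/-- (RECORD TWIN of `tcube`.) `□̃` as a set of sites of `T_η`: the centred `Lᵏ`-blow-up of `□̃^{(k)} = [a − 2ρ, a + M − 1 + 2ρ]ᵈ` — the top cube `[lo, hi] = [tLo, tHi]` of the
record tower of `B8Ineq130Rec`∕`B8Eq115GaugeFixingRec`∕`B8Ineq133Rec`. [cite: Balaban1985RegularSpaces, p.98 ("a cube which we denote by □̃"); Balaban1987RG1, (0.3) p.252] -/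
def tcubeZ (L : ℕ) (a : Site d) (M ρ k : ℕ) : Set (Site d) :=
  {x | InBox (tlo L (tLo a ρ) k) (thi L (tHi a M ρ) k) x}

/-- (RECORD TWIN of `LamP`.) **(1.131)** `Λ′_j = □_j^{(j)} ∖ □_{j+1}^{(j)}` (`1 ≤ j ≤ k − 1`), `Λ′_k = □_k^{(k)}`, `Λ′₀ = T ∖ □₁`, centred tower.
[cite: Balaban1985RegularSpaces, (1.131) p.99] -/
def LamPZ (L : ℕ) (a : Site d) (M ρ k j : ℕ) : Set (Site d) :=
  if j = 0 then {x | x ∉ cubeZ L a M ρ k 1}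
  else {z | InBox (sqLoZ L a ρ k j) (sqHiZ L a M ρ k j) z ∧
    (j < k → ¬ InBox (inLoZ L a ρ k j) (inHiZ L a M ρ k j) z)}

/-! ## §2. The fine-lattice margins `m_j = R₁M₁·Σ_{i=j}^{k} Lⁱ` (the engine's `margin_*` lemmas apply verbatim) -/

/-- Fine-lattice description of `□_j`: the margin-`Lʲ·ρ·gs L (k − j)` centred box at depth `k` (odd `L`). [cite: Balaban1985RegularSpaces, p.98 (bookkeeping)] -/
theorem cube_eq {L : ℕ} (hL : Odd L) {a : Site d} {M ρ k j : ℕ} (hj : j ≤ k) :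
    cubeZ L a M ρ k j = {x | InBox (bLoZ L a k (L ^ j * (ρ * gs L (k - j))))
      (bHiZ L a M k (L ^ j * (ρ * gs L (k - j)))) x} := by
  ext x
  simp only [cubeZ, sqLoZ, sqHiZ, tlo_bLo hL, thi_bHi hL, Nat.sub_add_cancel hj]

/-- Fine-lattice description of `□̃`: the margin-`2ρLᵏ` centred box at depth `k`. [cite: Balaban1985RegularSpaces, p.98 (bookkeeping)] -/
theorem tcube_eq {L : ℕ} (hL : Odd L) (a : Site d) (M ρ k : ℕ) :
    tcubeZ L a M ρ k = {x | InBox (bLoZ L a k (L ^ k * (2 * ρ))) (bHiZ L a M k (L ^ k * (2 * ρ))) x} := by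
  ext x
  simp only [tcubeZ, tLo_eq L, tHi_eq L, tlo_bLo hL, thi_bHi hL, Nat.zero_add]

/-- `□̃^{(j)}` (depth `n`): `tlo L tLo n =` the margin-`2ρLⁿ` centred box, lower corner. [cite: Balaban1985RegularSpaces, p.98 (bookkeeping)] -/
theorem tlo_tLo {L : ℕ} (hL : Odd L) (a : Site d) (ρ n : ℕ) : tlo L (tLo a ρ) n = bLoZ L a n (L ^ n * (2 * ρ)) := by
  rw [tLo_eq L, tlo_bLo hL, Nat.zero_add]

/-- Upper corner of `□̃^{(j)}`. [cite: Balaban1985RegularSpaces, p.98 (bookkeeping)] -/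
theorem thi_tHi {L : ℕ} (hL : Odd L) (a : Site d) (M ρ n : ℕ) : thi L (tHi a M ρ) n = bHiZ L a M n (L ^ n * (2 * ρ)) := by
  rw [tHi_eq L, thi_bHi hL, Nat.zero_add]

/-! ## §3. The printed inclusions, centred tower -/

/-- **`□_{j+1} ⊂ □_j`** (`j < k`). [cite: Balaban1985RegularSpaces, p.98 ("□_j ⊃ □_{j+1}")] -/
theorem cube_succ_subset {L : ℕ} (hL : Odd L) {a : Site d} {M ρ k j : ℕ} (hj : j < k) :
    cubeZ L a M ρ k (j + 1) ⊆ cubeZ L a M ρ k j := by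
  rw [cube_eq hL (le_of_lt hj), cube_eq hL (Nat.succ_le_of_lt hj)]
  intro x hx
  exact inBox_margin_mono (by rw [margin_succ hj]; exact Nat.le_add_right _ _) hx

/-- **`□ ⊂ □_k`**. [cite: Balaban1985RegularSpaces, p.98 ("□_k, □, such that □_j ⊃ □_{j+1}")] -/
theorem box_subset_cube_top {L : ℕ} (hL : Odd L) (a : Site d) (M ρ k : ℕ) : boxZ L a M k ⊆ cubeZ L a M ρ k k := by
  rw [cube_eq hL le_rfl]
  intro x hx
  exact inBox_margin_mono (Nat.zero_le _) hx

/-- `□_{j'} ⊂ □_j` for `j ≤ j' ≤ k`. [cite: Balaban1985RegularSpaces, p.98 (bookkeeping)] -/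
theorem cube_anti {L : ℕ} (hL : Odd L) {a : Site d} {M ρ k j j' : ℕ} (h : j ≤ j') (h' : j' ≤ k) :
    cubeZ L a M ρ k j' ⊆ cubeZ L a M ρ k j := by
  rw [cube_eq hL h', cube_eq hL (h.trans h')]
  intro x hx
  exact inBox_margin_mono (margin_anti L ρ k j j' h h') hx

/-- **`□ ⊂ □_j`** for every `j ≤ k`. [cite: Balaban1985RegularSpaces, p.98 (bookkeeping)] -/
theorem box_subset_cube {L : ℕ} (hL : Odd L) {a : Site d} {M ρ k j : ℕ} (hj : j ≤ k) : boxZ L a M k ⊆ cubeZ L a M ρ k j :=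
  (box_subset_cube_top hL a M ρ k).trans (cube_anti hL hj le_rfl)

/-- **`□_j ⊂ □̃`** (`j ≤ k`, `L ≥ 2`, `R₁M₁ ≥ 1`). [cite: Balaban1985RegularSpaces, p.98 ("We cover □₀ by a smallest family of cubes")] -/
theorem cube_subset_tcube {L : ℕ} (hL : Odd L) (hL2 : 2 ≤ L) {a : Site d} {M ρ k j : ℕ} (hρ : 1 ≤ ρ) (hj : j ≤ k) :
    cubeZ L a M ρ k j ⊆ tcubeZ L a M ρ k := by
  rw [cube_eq hL hj, tcube_eq hL]
  intro x hx
  exact inBox_margin_mono (Nat.le_of_succ_le (margin_collar hL2 hρ hj)) hx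

/-- The **collar**: every site within sup-distance `1` of `□_j` lies in `□̃` (hypothesis `hcol` of `B8Ineq132Rec.ineq132`). [cite: Balaban1985RegularSpaces, p.98 (display before (1.128))] -/
theorem collar_cube {L : ℕ} (hL : Odd L) (hL2 : 2 ≤ L) {a : Site d} {M ρ k j : ℕ} (hρ : 1 ≤ ρ) (hj : j ≤ k) :
    Collar (cubeZ L a M ρ k j) (tlo L (tLo a ρ) k) (thi L (tHi a M ρ) k) := by
  intro v hv y hy
  rw [cube_eq hL hj] at hv
  rw [tlo_tLo hL, thi_tHi hL]
  have hm := margin_collar hL2 hρ hj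
  set m := L ^ j * (ρ * gs L (k - j)) with hm_def
  have hmz : (m : ℤ) + 1 ≤ ((L ^ k * (2 * ρ) : ℕ) : ℤ) := by exact_mod_cast hm
  intro i
  obtain ⟨h1, h2⟩ := hv i
  obtain ⟨h3, h4⟩ := hy i
  simp only [bLoZ, bHiZ] at h1 h2 ⊢
  constructor <;> linarith

/-- **`□_j^{(j)} ⊂ □̃^{(j)}`** on the `j`-lattice (depth `k − j`), componentwise. [cite: Balaban1985RegularSpaces, (1.133) p.99 ("on □_j^{(j)}")] -/
theorem sq_le_tilde {L : ℕ} (hL : Odd L) (hL2 : 2 ≤ L) (a : Site d) (M ρ k j : ℕ) :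
    tlo L (tLo a ρ) (k - j) ≤ sqLoZ L a ρ k j ∧ sqHiZ L a M ρ k j ≤ thi L (tHi a M ρ) (k - j) := by
  rw [tlo_tLo hL, thi_tHi hL]
  exact le_of_margin_mono (margin_own hL2 (k - j))

/-- **`Λ′_j ⊂ □_j^{(j)} ⊂ □̃^{(j)}`** for `1 ≤ j ≤ k` (hypothesis `hΛ` of `B8Ineq132Rec.ineq132`). [cite: Balaban1985RegularSpaces, (1.131) p.99] -/
theorem lamP_subset {L : ℕ} (hL : Odd L) (hL2 : 2 ≤ L) (a : Site d) (M ρ k : ℕ) :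
    ∀ j, 1 ≤ j → j ≤ k → ∀ x ∈ LamPZ L a M ρ k j, tlo L (tLo a ρ) (k - j) ≤ x ∧ x ≤ thi L (tHi a M ρ) (k - j) := by
  intro j hj _ x hx
  have hj0 : j ≠ 0 := by omega
  simp only [LamPZ, if_neg hj0, Set.mem_setOf_eq] at hx
  obtain ⟨hsq, -⟩ := hx
  obtain ⟨h1, h2⟩ := sq_le_tilde hL hL2 a M ρ k j
  exact ⟨fun i => (h1 i).trans (hsq i).1, fun i => (hsq i).2.trans (h2 i)⟩

/-- `Λ′_k = □_k^{(k)} ⊇ □^{(k)}`: the unit-lattice cube itself lies in `ℭ_k` (`k ≥ 1`). [cite: Balaban1985RegularSpaces, (1.131) p.99 ("Λ′_k = □_k^{(k)}")] -/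
theorem box_subset_lamP_top {L : ℕ} {a : Site d} {M ρ k : ℕ} (hk : 1 ≤ k) :
    boxZ L a M 0 ⊆ LamPZ L a M ρ k k := by
  intro x hx
  have hk0 : k ≠ 0 := by omega
  simp only [LamPZ, if_neg hk0, Set.mem_setOf_eq, lt_irrefl, IsEmpty.forall_iff, and_true]
  simp only [boxZ, Set.mem_setOf_eq, sqLoZ, sqHiZ, Nat.sub_self] at hx ⊢
  exact inBox_margin_mono (Nat.zero_le _) hx

/-- `□_{j+1}^{(j)} = B(□_{j+1}^{(j+1)})` (centred blocks): the inner box of `Λ′_j` is the one-step centred blow-up of `□_{j+1}` traced on its own lattice (`j < k`).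
[cite: Balaban1985RegularSpaces, (1.131) p.99; Balaban1987RG1, (0.3) p.252] -/
theorem inner_eq_blowup {L : ℕ} (hL : Odd L) (a : Site d) (M ρ : ℕ) {k j : ℕ} (hj : j < k) :
    inLoZ L a ρ k j = tlo L (sqLoZ L a ρ k (j + 1)) 1 ∧ inHiZ L a M ρ k j = thi L (sqHiZ L a M ρ k (j + 1)) 1 := by
  obtain ⟨n, hn⟩ : ∃ n, k - j = n + 1 := ⟨k - (j + 1), by omega⟩
  have hn' : k - (j + 1) = n := by omega
  have hm : ρ * (gs L (n + 1) - 1) = L ^ 1 * (ρ * gs L n) := by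
    rw [gs_succ, Nat.add_sub_cancel, pow_one]; ring
  simp only [inLoZ, inHiZ, sqLoZ, sqHiZ, tlo_bLo hL, thi_bHi hL, hn, hn', hm, and_self]

/-- For `j = k` the inner box is `□^{(k)} = [a, a + M − 1]ᵈ` itself («□_{k+1} = □»). [cite: Balaban1985RegularSpaces, p.98 ("□_k, □")] -/
theorem inner_top (L : ℕ) (a : Site d) (M ρ k : ℕ) :
    inLoZ L a ρ k k = bLoZ L a 0 0 ∧ inHiZ L a M ρ k k = bHiZ L a M 0 0 := by
  simp [inLoZ, inHiZ]

/-! ## §4. Block compatibility (centred): «`□_j` is a sum of the big blocks of the lattice `T_{L^{−j}}`» -/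

/-- **Block compatibility (centred)**: `x ∈ □_j` iff the centred `Lʲ`-block of `T_η` containing `x` is a block of `□_j^{(j)}`, i.e. `□_j = Bʲ(□_j^{(j)})` (odd `L`).
[cite: Balaban1985RegularSpaces, p.98 ("for every j the cube □_j is a sum of the big blocks of the lattice T_{L^{-j}}"); Balaban1987RG1, (0.3) p.252] -/
theorem mem_cube_iff {L : ℕ} (hL : Odd L) {a : Site d} {M ρ k j : ℕ} {x : Site d} :
    x ∈ cubeZ L a M ρ k j ↔ ∃ z, InBox (sqLoZ L a ρ k j) (sqHiZ L a M ρ k j) z ∧ UnderZ L j z x := by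
  constructor
  · intro hx
    refine ⟨flmZ L j x, ?_, underZ_flmZ hL j x⟩
    have hB := underZ_flmZ hL j x
    have hL0 : (0 : ℤ) < (L : ℤ) ^ j := by have := hL.pos; positivity
    have hc : 2 * (ctrShift L j : ℤ) + 1 = (L : ℤ) ^ j := by exact_mod_cast two_mul_ctrShift_add_one hL j
    intro i
    obtain ⟨h1, h2⟩ := hx i
    obtain ⟨h3, h4⟩ := hB i
    rw [tlo_apply hL] at h1
    rw [thi_apply hL] at h2
    constructor
    · have h5 : (L : ℤ) ^ j * sqLoZ L a ρ k j i < (L : ℤ) ^ j * (flmZ L j x i + 1) := by linarith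
      exact Int.lt_add_one_iff.mp (lt_of_mul_lt_mul_left h5 hL0.le)
    · have h5 : (L : ℤ) ^ j * flmZ L j x i < (L : ℤ) ^ j * (sqHiZ L a M ρ k j i + 1) := by linarith
      exact Int.lt_add_one_iff.mp (lt_of_mul_lt_mul_left h5 hL0.le)
  · rintro ⟨z, hz, hU⟩
    have hz1 : tlo L (sqLoZ L a ρ k j) 0 ≤ z := fun i => by rw [tlo_zero]; exact (hz i).1
    have hz2 : z ≤ thi L (sqHiZ L a M ρ k j) 0 := fun i => by rw [thi_zero]; exact (hz i).2
    have h := underZ_tower hL (m := j) hz1 hz2 hU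
    rw [Nat.zero_add] at h
    exact inBox_of_le h.1 h.2

/-! ## §5. The family `{Ω_j}`: «thus we have `□̃ ⊂ Ω_{k−1}`» and «`□_k ⊂ Ω_{k−1}`, `□_j ⊂ Ω_j`, `j < k`», centred tower -/

/-- **«thus we have `□̃ ⊂ Ω_{k−1}`»** (p. 98), centred tower: from `□ ⊂ Ω_k`, the separation (1.4) `(L^{k−1}η)^{−1} dist(Ω_{k−1}ᶜ, Ω_k) > RM₁` (fine units, `ℓ¹`) and
«`L⁻¹RM > 2dR₁M₁`»: every site of `□̃` is within `ℓ¹`-distance `2dR₁M₁Lᵏ` of `□`. [cite: Balaban1985RegularSpaces, p.98 ("for example L⁻¹RM > 2dR₁M₁, thus we have □̃ ⊂ Ω_{k-1}"), (1.4) p.77] -/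
theorem tcube_subset_of_sep {L : ℕ} (hL : Odd L) {a : Site d} {M ρ k : ℕ} (hk : 1 ≤ k) (hM : 1 ≤ M)
    {Ω : ℕ → Set (Site d)} {R M₁ : ℕ} (hbox : boxZ L a M k ⊆ Ω k)
    (hsep : ∀ x, x ∉ Ω (k - 1) → ∀ y ∈ Ω k, ((R * M₁ * L ^ (k - 1) : ℕ) : ℤ) < l1dist x y)
    (hR : 2 * d * ρ * L < R * M₁) : tcubeZ L a M ρ k ⊆ Ω (k - 1) := by
  have hL1 : 1 ≤ L := hL.pos
  intro x hx
  rw [tcube_eq hL] at hx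
  -- the nearest point of `□` (centred blow-up: both corners shifted by `−c_k`)
  set c : ℤ := (ctrShift L k : ℤ) with hc_def
  set y : Site d := fun i =>
    if x i < (L : ℤ) ^ k * a i - c then (L : ℤ) ^ k * a i - c
    else if (L : ℤ) ^ k * (a i + M) - 1 - c < x i then (L : ℤ) ^ k * (a i + M) - 1 - c else x i with hy_def
  have hLk : (1 : ℤ) ≤ (L : ℤ) ^ k := by exact_mod_cast Nat.one_le_pow k L hL1
  have hMz : (1 : ℤ) ≤ M := by exact_mod_cast hM
  have hLM : (1 : ℤ) ≤ (L : ℤ) ^ k * M := by nlinarith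
  have hyb : y ∈ boxZ L a M k := by
    intro i
    simp only [hy_def, bLoZ, bHiZ, Nat.cast_zero, sub_zero, add_zero]
    have e1 : (L : ℤ) ^ k * (a i + M) = (L : ℤ) ^ k * a i + (L : ℤ) ^ k * M := by ring
    split_ifs with h1 h2 <;> constructor <;> linarith
  have hdist : ∀ i, |x i - y i| ≤ (L : ℤ) ^ k * (2 * ρ) := by
    intro i
    obtain ⟨h1, h2⟩ := hx i
    simp only [bLoZ, bHiZ] at h1 h2
    push_cast at h1 h2
    have e1 : (L : ℤ) ^ k * (a i + M) = (L : ℤ) ^ k * a i + (L : ℤ) ^ k * M := by ring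
    have hρ0 : (0 : ℤ) ≤ (L : ℤ) ^ k * (2 * ρ) := by positivity
    simp only [hy_def]
    split_ifs with h3 h4
    · rw [abs_le]; constructor <;> linarith
    · rw [abs_le]; constructor <;> linarith
    · simp [hρ0]
  have hsum : l1dist x y ≤ (d : ℤ) * ((L : ℤ) ^ k * (2 * ρ)) := by
    unfold l1dist
    calc ∑ i, |x i - y i| ≤ ∑ _i : Fin d, (L : ℤ) ^ k * (2 * ρ) := Finset.sum_le_sum fun i _ => hdist i
      _ = (d : ℤ) * ((L : ℤ) ^ k * (2 * ρ)) := by simp [Finset.sum_const]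
  by_contra hxΩ
  have h1 := hsep x hxΩ y (hbox hyb)
  obtain ⟨k', rfl⟩ : ∃ k', k = k' + 1 := ⟨k - 1, by omega⟩
  simp only [Nat.add_sub_cancel] at h1
  have hRz : ((2 * d * ρ * L : ℕ) : ℤ) < ((R * M₁ : ℕ) : ℤ) := by exact_mod_cast hR
  push_cast at h1 hRz
  have hLk' : (0 : ℤ) < (L : ℤ) ^ k' := by positivity
  have h2 : (d : ℤ) * ((L : ℤ) ^ (k' + 1) * (2 * ρ)) = (2 * d * ρ * L) * (L : ℤ) ^ k' := by ring
  have h3 : (2 * (d : ℤ) * ρ * L) * (L : ℤ) ^ k' < (R * M₁ : ℤ) * (L : ℤ) ^ k' :=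
    mul_lt_mul_of_pos_right hRz hLk'
  linarith

/-- **«`□_k ⊂ Ω_{k−1}`, `□_j ⊂ Ω_j`, `j < k`»** (p. 99) — indeed `□_j ⊂ Ω_{k−1}` for every `j ≤ k` — from `□̃ ⊂ Ω_{k−1}` and the nesting (1.3), centred tower.
[cite: Balaban1985RegularSpaces, p.99 ("□_k ⊂ Ω_{k-1}, □_j ⊂ Ω_j, j < k"), (1.3) p.77] -/
theorem cube_subset_Omega {L : ℕ} (hL : Odd L) (hL2 : 2 ≤ L) {a : Site d} {M ρ k : ℕ} (hρ : 1 ≤ ρ) {Ω : ℕ → Set (Site d)}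
    (hnest : ∀ j, j < k → Ω (j + 1) ⊆ Ω j) (hT : tcubeZ L a M ρ k ⊆ Ω (k - 1)) :
    (∀ j, j ≤ k → cubeZ L a M ρ k j ⊆ Ω (k - 1)) ∧ (∀ j, j < k → cubeZ L a M ρ k j ⊆ Ω j) := by
  have h1 : ∀ j, j ≤ k → cubeZ L a M ρ k j ⊆ Ω (k - 1) := fun j hj => (cube_subset_tcube hL hL2 hρ hj).trans hT
  refine ⟨h1, fun j hj => (h1 j hj.le).trans ?_⟩
  have hmono : ∀ n, ∀ j, j + n ≤ k - 1 → Ω (j + n) ⊆ Ω j := by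
    intro n
    induction n with
    | zero => intro j _; simp
    | succ n ih =>
      intro j hjn
      exact (hnest (j + n) (by omega)).trans (ih j (by omega))
  have := hmono (k - 1 - j) j (by omega)
  rwa [show j + (k - 1 - j) = k - 1 by omega] at this

end Geometry

/-! ## §6. (1.132)∕(1.133) for the printed family, record tower -/

section Analytic

variable {𝔸 : Type*} [NormedRing 𝔸] [NormOneClass 𝔸] [NormedAlgebra ℂ 𝔸] [CompleteSpace 𝔸]

/-- **(1.132) and (1.133) for the family (1.131), RECORD TOWER** (twin of `B8Eq131Cubes.ineq132_cubes`): for `U₀ ∈ 𝔄_k({Ω_j}, α₀)` and `□̃ ⊂ Ω_{k−1}`, the cut-off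
`U₀″ = B8Ineq133Rec.cutFixedZ` on the centred tower over `□̃^{(k)} = [a − 2R₁M₁, a + M − 1 + 2R₁M₁]ᵈ` (centre `ctr`, any orbit, any `AvgClosedZ` gauge group, odd `L ≥ 3`)
satisfies `U₀″ ∈ 𝔄_k({□_j}, L³α₀)` with `□_j = cubeZ … j`, `U₀″ ∈ Ax_k(ℭ_k, 1)` (`InAxOneZ`) with `Λ′_j = LamPZ … j`, and `|Ū₀″ʲ − 1| < 6dL²Mα₀` on the bonds of
`□_j^{(j)} = [sqLoZ j, sqHiZ j]`, `j = 0, …, k`; the geometric hypotheses of `B8Ineq132Rec.ineq132` are DISCHARGED by §2–§4 (`R₁M₁ ↦ ρ ≥ 1`, `M ≥ ρ`).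
[cite: Balaban1985RegularSpaces, (1.131)-(1.133) p.99, p.98; Balaban1987RG1, (0.4) p.253] -/
theorem ineq132_cubes {L s : ℕ} (hLs : L = 2 * s + 1) (hL : 2 ≤ L) (hd : 1 ≤ d) {G : Subgroup 𝔸ˣ} (hG : AvgClosedZ d L G) (k : ℕ)
    (U : Site d → Fin d → 𝔸ˣ) (hU : ∀ x κ, U x κ ∈ G) {α₀ : ℝ} (hα : 0 < α₀)
    (hα3 : C0Z d * (α₀ * (L : ℝ) ^ 2) ≤ 1 / 3) (hα2 : 2 * (α₀ * (L : ℝ) ^ 2) ≤ c2' d L)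
    (a : Site d) {M ρ : ℕ} (hρ : 1 ≤ ρ) (hρM : ρ ≤ M) (hM : 11 * (d : ℝ) < M)
    {η : ℝ} (hη : 0 < η) {Ω : ℕ → Set (Site d)} (hA : InAk L k η α₀ Ω U)
    (hT : tcubeZ L a M ρ k ⊆ Ω (k - 1))
    (hsmall : 11 * (d : ℝ) ^ 2 * (L : ℝ) ^ 2 * α₀ + ((M : ℝ) + 4 * ρ) * d * (L : ℝ) ^ 2 * α₀ ≤ 1 / 6) :
    InAk L k η ((L : ℝ) ^ 3 * α₀) (cubeZ L a M ρ k) (cutFixedZ L (tLo a ρ) (tHi a M ρ) U k (ctr a M)) ∧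
    InAxOneZ L k (LamPZ L a M ρ k) (cutFixedZ L (tLo a ρ) (tHi a M ρ) U k (ctr a M)) ∧
    ∀ j, j ≤ k → ∀ (x : Site d) (ν : Fin d), sqLoZ L a ρ k j ≤ x → x + e ν ≤ sqHiZ L a M ρ k j →
      ‖((avgIterZ L (cutFixedZ L (tLo a ρ) (tHi a M ρ) U k (ctr a M)) j x ν : 𝔸ˣ) : 𝔸) - 1‖ <
        6 * d * (L : ℝ) ^ 2 * M * α₀ := by
  have hLo : Odd L := ⟨s, hLs⟩
  have hM1 : 1 ≤ M := hρ.trans hρM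
  obtain ⟨hy, hy', hrad⟩ := ctr_mem (a := a) (ρ := ρ) hM1
  have hRM : (ρ : ℝ) * 1 ≤ (M : ℝ) := by rw [mul_one]; exact_mod_cast hρM
  have hsmall' : 11 * (d : ℝ) ^ 2 * (L : ℝ) ^ 2 * α₀ + ((M : ℝ) + 4 * ρ * 1) * d * (L : ℝ) ^ 2 * α₀ ≤ 1 / 6 := by
    rwa [mul_one]
  have hΩ : ∃ l, l ≤ k ∧ k ≤ l + 1 ∧ ∀ x, InBox (tlo L (tLo a ρ) k) (thi L (tHi a M ρ) k) x → x ∈ Ω l :=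
    ⟨k - 1, Nat.sub_le _ _, by omega, fun x hx => hT hx⟩
  have hsq : ∀ j, j ≤ k → ∃ l, l ≤ k ∧ j ≤ l + 1 ∧ cubeZ L a M ρ k j ⊆ Ω l :=
    fun j hj => ⟨k - 1, Nat.sub_le _ _, by omega, (cube_subset_tcube hLo hL hρ hj).trans hT⟩
  have hcol : ∀ j, j ≤ k → Collar (cubeZ L a M ρ k j) (tlo L (tLo a ρ) k) (thi L (tHi a M ρ) k) :=
    fun j hj => collar_cube hLo hL hρ hj
  obtain ⟨h132a, h132b, h133⟩ := ineq132 hLs hL hd hG k U hU hα hα3 hα2 (tLo a ρ) (tHi a M ρ) (tLo_le_tHi hM1)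
    hη hA hΩ hsq hcol (lamP_subset hLo hL a M ρ k) hy hy' hrad (two_crad_le M ρ) hRM hM hsmall'
  refine ⟨h132a, h132b, fun j hj x ν hx hx' => ?_⟩
  obtain ⟨h1, h2⟩ := sq_le_tilde hLo hL a M ρ k j
  have h := h133 (k - j) (Nat.sub_le _ _) x ν (fun i => (h1 i).trans (hx i)) (fun i => (hx' i).trans (h2 i))
  rwa [Nat.sub_sub_self hj] at h

/-- The same with print's DERIVATION of `□̃ ⊂ Ω_{k−1}` (§5) in place of the hypothesis: `□ ⊂ Ω_k`, the separation (1.4) at level `k − 1` (`ℓ¹`, fine units) and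
«`L⁻¹RM₁ > 2dR₁M₁`», `k ≥ 1`; record tower. [cite: Balaban1985RegularSpaces, (1.131)-(1.133) p.99, p.98, (1.4) p.77; Balaban1987RG1, (0.4) p.253] -/
theorem ineq132_cubes_of_sep {L s : ℕ} (hLs : L = 2 * s + 1) (hL : 2 ≤ L) (hd : 1 ≤ d) {G : Subgroup 𝔸ˣ} (hG : AvgClosedZ d L G)
    {k : ℕ} (hk : 1 ≤ k) (U : Site d → Fin d → 𝔸ˣ) (hU : ∀ x κ, U x κ ∈ G) {α₀ : ℝ} (hα : 0 < α₀)
    (hα3 : C0Z d * (α₀ * (L : ℝ) ^ 2) ≤ 1 / 3) (hα2 : 2 * (α₀ * (L : ℝ) ^ 2) ≤ c2' d L)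
    (a : Site d) {M ρ : ℕ} (hρ : 1 ≤ ρ) (hρM : ρ ≤ M) (hM : 11 * (d : ℝ) < M)
    {η : ℝ} (hη : 0 < η) {Ω : ℕ → Set (Site d)} (hA : InAk L k η α₀ Ω U)
    {R M₁ : ℕ} (hbox : boxZ L a M k ⊆ Ω k)
    (hsep : ∀ x, x ∉ Ω (k - 1) → ∀ y ∈ Ω k, ((R * M₁ * L ^ (k - 1) : ℕ) : ℤ) < l1dist x y)
    (hR : 2 * d * ρ * L < R * M₁)
    (hsmall : 11 * (d : ℝ) ^ 2 * (L : ℝ) ^ 2 * α₀ + ((M : ℝ) + 4 * ρ) * d * (L : ℝ) ^ 2 * α₀ ≤ 1 / 6) :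
    InAk L k η ((L : ℝ) ^ 3 * α₀) (cubeZ L a M ρ k) (cutFixedZ L (tLo a ρ) (tHi a M ρ) U k (ctr a M)) ∧
    InAxOneZ L k (LamPZ L a M ρ k) (cutFixedZ L (tLo a ρ) (tHi a M ρ) U k (ctr a M)) ∧
    ∀ j, j ≤ k → ∀ (x : Site d) (ν : Fin d), sqLoZ L a ρ k j ≤ x → x + e ν ≤ sqHiZ L a M ρ k j →
      ‖((avgIterZ L (cutFixedZ L (tLo a ρ) (tHi a M ρ) U k (ctr a M)) j x ν : 𝔸ˣ) : 𝔸) - 1‖ <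
        6 * d * (L : ℝ) ^ 2 * M * α₀ :=
  ineq132_cubes hLs hL hd hG k U hU hα hα3 hα2 a hρ hρM hM hη hA
    (tcube_subset_of_sep ⟨s, hLs⟩ hk (hρ.trans hρM) hbox hsep hR) hsmall

end Analytic

end Literature.MathematicalPhysics.QuantumFieldTheory.Balaban1983to89.B8Eq131CubesRec

/-! ## Axiom audit (gate whitelist: `propext`, `Classical.choice`, `Quot.sound`) -/
#print axioms Literature.MathematicalPhysics.QuantumFieldTheory.Balaban1983to89.B8Eq131CubesRec.ineq132_cubes
#print axioms Literature.MathematicalPhysics.QuantumFieldTheory.Balaban1983to89.B8Eq131CubesRec.mem_cube_iff
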